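import Literature.NumberTheory.Automorphic.Liu2021.LemD1Item3AtVIsoOfLineTransport
import Literature.NumberTheory.Automorphic.Liu2021.LemD1Item4AsPrintedIndexed
import HarnessLib

/-!
# [Liu2021, Lem. D.1] on the RANK-`≥ 2` indexed family `localIndexedFamilyAtV₂ … (Equiv.prodUnique (Fin N) (Fin 1)) … v`: two members whose
# transported sections are LINE-TRANSPORTS of each other and whose Step-3 characters agree have isomorphic `ω(μ, ε, χ)` — THEOREMS ONLY

Topic `NumberTheory/Automorphic/Liu2021`; namespace `Literature.NumberTheory.Automorphic.Liu2021.Def411WeilCarriers` (the indexed families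
`localIndexedFamilyAtV` ∕ `localIndexedFamilyAtV₂` of `Def411WeilCarriersLocalDataAtV.lean` ∕ `LemD1Item4AsPrintedIndexed.lean`).  KERNEL ONLY:
theorems, no definition, no named fact, no `sorry`.  Nothing of [Liu2021] or [MoeglinVignerasWaldspurger1987] is asserted.

## What this file is, and why (cell hodgecm-mathlib, P5, crux `HLiu418`, letter L4-if `LemD1RankTwoCMLetters.LemD1_4IfAsPrintedNonsplitCM₂`)

★ `LemD1Item3AtVIsoOfLineTransport.lean` proves, on the rank-`≥ 3` indexed family `localIndexedFamilyAtV` (the currency of [Lem. D.1 (3)], which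
is printed under «`n ≥ 3`»), the ISOMETRY-TRANSPORT plumbing «line-transported sections + equal `χ` ⟹ `ω(μ_j, ε_j, χ_j) ≅ ω(μ_i, ε_i, χ_i)`».
The in-house road for the last local letter L4-if of fan-B row #74 ([Lem. D.1 (4)], «if» direction, printed under «`n = 2`»; A-p18 (g24)'s
ROAD CARD v4, link (CM) «class move») needs the SAME plumbing on the rank-`≥ 2` sibling family ★ `localIndexedFamilyAtV₂` (A-p15∕B-p13's
`LemD1Item4AsPrintedIndexed.lean`; SAME BODY, `2 ≤ n` in place of `3 ≤ n`).  This file is that sibling — the SAME PROOFS, with the rank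
hypothesis `hn : 2 ≤ N` fed to `uEquiv` directly:

* §1 `sameClass_eps_localIndexedFamilyAtV₂_iff` — the `ε`-summand `LemD1.SameClass (eps i) (eps j)` on the rank-`≥ 2` family is the units
  equation `(a_j δ) ⊗ 1 = x · xᶜ · ((a_i δ) ⊗ 1)` (`Iff.rfl`; sibling of ★ `sameClass_eps_localIndexedFamilyAtV_iff`);
* §2 `exists_lineDelta_witness_of_sameClass_eps₂` — it yields a unit `x` with `a_j⁻¹δ ⊗ 1 = x xᶜ (a_i⁻¹δ ⊗ 1)`, the hypothesis `hx` of ★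
  `lineTransportSplitting` at the transported lines `δ'_t = a_t⁻¹ δ` (sibling of ★ `exists_lineDelta_witness_of_sameClass_eps`);
* §3 **`areIsomorphicRep_quot_of_lineTransportSplitting_eq_prodUnique₂`** — for the rank-`≥ 2` family at `Equiv.prodUnique (Fin N) (Fin 1)`
  (ANY finite place `v`, ANY splitting families `𝓢_t`, ANY Step-2 characters): `lineTransportSplitting … x … (s_i) = s_j` and `chi j = chi i` ⟹
  `AreIsomorphicRep (quot j) (quot i)` (sibling of ★ `areIsomorphicRep_quot_of_lineTransportSplitting_eq_prodUnique`);
* §4 `areIsomorphicRep_theta_of_lineTransportSplitting_eq_prodUnique₂` — the same read in the Θ-currency of ★ (r1)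
  `areIsomorphicRep_localType₂_iff_quot`: `Θ_v(j) ≅ Θ_v(i)` as representations of `U(J_V)(F_v)` (the tokens the L4-if assembler composes).

HC_CM is proved only modulo the printed citations (the 2 remaining named inputs `hLiu418`, `h413`) until rung 0 closes; this file discharges
none of them and no interface fact (it is place-free plumbing for one link of the L4-if road).

## References
* [Liu2021] Y. Liu, Camb. J. Math. 9 (2021) = arXiv:2102.11518 — App. D §D.1 Steps 1–3 (l. 5213–5224), Lemma D.1 (3)–(4) (l. 5233–5235).
* [MoeglinVignerasWaldspurger1987] C. Mœglin, M.-F. Vignéras, J.-L. Waldspurger, LNM 1291, Chap. 2 II.1 (A)–(B), Chap. 3 I.1–I.3, IV.4.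
* [HarrisKudlaSweet1996] M. Harris, S. Kudla, W. Sweet, JAMS 9 (1996), §1 (splittings transported along isometries).
-/

set_option autoImplicit false

noncomputable section

open scoped Matrix Kronecker
open NumberField IsDedekindDomain
open Literature.NumberTheory.Automorphic Literature.NumberTheory.Automorphic.UnitaryGroup
open Literature.RepresentationTheory
open Literature.RepresentationTheory.HeisenbergGroup (MpPsi)
open Literature.NumberTheory.GelbartRogawski1991 Literature.NumberTheory.GelbartRogawski1991.UnitaryDualPair
open Literature.NumberTheory.GelbartRogawski1991.UnitaryDualPair.LocalSplitting
open Literature.NumberTheory.GelbartRogawski1991.UnitaryDualPair.WeilCoinv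

namespace Literature.NumberTheory.Automorphic.Liu2021.Def411WeilCarriers

open Literature.RepresentationTheory.MoeglinVignerasWaldspurger1987

variable (F E : Type) [Field F] [NumberField F] [Field E] [NumberField E] [Algebra F E]
variable (c : E ≃ₐ[F] E) (N : ℕ) (JV : Matrix (Fin N) (Fin N) E) {TV : Matrix (Fin N) (Fin N) F}
variable [Algebra.IsQuadraticExtension F E] {δ : E} (hcδ : c δ = -δ) (hδ : δ ≠ 0) {d : F} (hd : δ * δ = algebraMap F E d)

/-! ## §1 The `ε`-summand on the rank-`≥ 2` family is a units equation -/

/-- **The `ε`-summand on the rank-`≥ 2` indexed family is a units equation**: `LemD1.SameClass (eps i) (eps j)` (READING L3′) for the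
Step-1 representatives `(a_i δ) ⊗ 1`, `(a_j δ) ⊗ 1` of ★ `localIndexedFamilyAtV₂ … v` says literally `(a_j δ) ⊗ 1 = x · xᶜ · ((a_i δ) ⊗ 1)` for
a unit `x` of `E_v` (`Iff.rfl`; rank-`≥ 2` sibling of ★ `sameClass_eps_localIndexedFamilyAtV_iff`).
[cite: Liu2021, App. D §D.1 Step 1 (l. 5217), Lemma D.1 (4) (l. 5235)] -/
theorem sameClass_eps_localIndexedFamilyAtV₂_iff {n : ℕ} (e : Fin N × Fin 1 ≃ Fin n) (hV : TV.IsSymm) (hVd : IsUnit TV.det)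
    (hJV : JV = TV.map (algebraMap F E))
    (hn : 2 ≤ n) {ι : Type} (aOf : ι → Fˣ) (χOf : ι → Chi F E c)
    (𝓢Of : ∀ i, LocalSplitting.FinLocalSplittings F E c n hcδ hδ hd (gram F e TV (TW F (aOf i))) (isSymm_gram F e hV (isSymm_TW F (aOf i)))
      (reindex_kronecker_eq_gram_map F E e hJV (JW_eq F E (aOf i))))
    (μOf : ι → ∀ v : HeightOneSpectrum (𝓞 F), (LocalRing E v)ˣ →* ℂˣ) (hμn : ∀ i v x, ‖((μOf i v x : ℂˣ) : ℂ)‖ = 1)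
    (hμc : ∀ i v, Continuous fun x => ((μOf i v x : ℂˣ) : ℂ))
    (hμF : ∀ (i : ι) (v : HeightOneSpectrum (𝓞 F)) (t : (v.adicCompletion F)ˣ),
      μOf i v (Units.map (algebraMap (v.adicCompletion F) (LocalRing E v)).toMonoidHom t) = 1 ↔
        ∃ x : (LocalRing E v)ˣ, (x : LocalRing E v) * conjLocal E c v x = algebraMap (v.adicCompletion F) (LocalRing E v) t)
    (v : HeightOneSpectrum (𝓞 F)) (i j : ι) :
    LemD1.SameClass ((localIndexedFamilyAtV₂ F E c N e JV hcδ hδ hd hV hVd hJV hn aOf χOf 𝓢Of μOf hμn hμc hμF v).eps i)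
        ((localIndexedFamilyAtV₂ F E c N e JV hcδ hδ hd hV hVd hJV hn aOf χOf 𝓢Of μOf hμn hμc hμF v).eps j) ↔
      ∃ x : (LocalRing E v)ˣ, epsLine E hδ (aOf j) v =
        x * Units.map (conjLocal E c v : LocalRing E v →* LocalRing E v) x * epsLine E hδ (aOf i) v :=
  Iff.rfl

/-! ## §2 The `ε`-summand supplies the class witness `x` at the transported lines `a_t⁻¹ δ` -/

/-- **The `ε`-summand yields the witness of the isometry transport** on the rank-`≥ 2` family: for members `i, j` (any reindexing `e`,
representatives `eps t = (a_t δ) ⊗ 1`), `LemD1.SameClass (eps i) (eps j)` gives a unit `x` of `E_v` with `a_j⁻¹δ ⊗ 1 = x · xᶜ · (a_i⁻¹δ ⊗ 1)` —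
the hypothesis `hx` of ★ `lineTransportSplitting` at the lines `δ'_i = a_i⁻¹δ`, `δ'_j = a_j⁻¹δ` (the two pairs of representatives differ by the
norms `a_t · a_tᶜ = a_t²`, ★ `sameClass_epsLine_iff_sameClass_eps_lineDelta`); rank-`≥ 2` sibling of ★ `exists_lineDelta_witness_of_sameClass_eps`.
[cite: Liu2021, App. D §D.1 Step 1 (l. 5217), Lemma D.1 (4) (l. 5235)] [cite: MoeglinVignerasWaldspurger1987, Chap. 3 I.1–I.3] -/
theorem exists_lineDelta_witness_of_sameClass_eps₂ {n : ℕ} (e : Fin N × Fin 1 ≃ Fin n)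
    (hV : TV.IsSymm) (hVd : IsUnit TV.det) (hJV : JV = TV.map (algebraMap F E))
    (hn : 2 ≤ n) {ι : Type} (aOf : ι → Fˣ) (χOf : ι → Chi F E c)
    (𝓢Of : ∀ i, LocalSplitting.FinLocalSplittings F E c n hcδ hδ hd (gram F e TV (TW F (aOf i))) (isSymm_gram F e hV (isSymm_TW F (aOf i)))
      (reindex_kronecker_eq_gram_map F E e hJV (JW_eq F E (aOf i))))
    (μOf : ι → ∀ v : HeightOneSpectrum (𝓞 F), (LocalRing E v)ˣ →* ℂˣ) (hμn : ∀ i v x, ‖((μOf i v x : ℂˣ) : ℂ)‖ = 1)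
    (hμc : ∀ i v, Continuous fun x => ((μOf i v x : ℂˣ) : ℂ))
    (hμF : ∀ (i : ι) (v : HeightOneSpectrum (𝓞 F)) (t : (v.adicCompletion F)ˣ),
      μOf i v (Units.map (algebraMap (v.adicCompletion F) (LocalRing E v)).toMonoidHom t) = 1 ↔
        ∃ x : (LocalRing E v)ˣ, (x : LocalRing E v) * conjLocal E c v x = algebraMap (v.adicCompletion F) (LocalRing E v) t)
    (v : HeightOneSpectrum (𝓞 F)) (i j : ι)
    (h : LemD1.SameClass ((localIndexedFamilyAtV₂ F E c N e JV hcδ hδ hd hV hVd hJV hn aOf χOf 𝓢Of μOf hμn hμc hμF v).eps i)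
      ((localIndexedFamilyAtV₂ F E c N e JV hcδ hδ hd hV hVd hJV hn aOf χOf 𝓢Of μOf hμn hμc hμF v).eps j)) :
    ∃ x : (LocalRing E v)ˣ, algebraMap E (LocalRing E v) (algebraMap F E (↑(aOf j)⁻¹ : F) * δ) =
      (x : LocalRing E v) * conjLocal E c v x * algebraMap E (LocalRing E v) (algebraMap F E (↑(aOf i)⁻¹ : F) * δ) := by
  obtain ⟨x, hx⟩ := (sameClass_epsLine_iff_sameClass_eps_lineDelta F E c v (aOf i) (aOf j) (hδ := hδ)).1
    ((sameClass_eps_localIndexedFamilyAtV₂_iff F E c N JV hcδ hδ hd e hV hVd hJV hn aOf χOf 𝓢Of μOf hμn hμc hμF v i j).1 h)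
  refine ⟨x, ?_⟩
  rw [Units.ext_iff, Units.val_mul, Units.val_mul, Units.coe_map] at hx
  exact hx

/-! ## §3 «line-transported sections + equal `χ` ⟹ isomorphic `ω(μ, ε, χ)`» on the rank-`≥ 2` family at `Equiv.prodUnique` -/

/-- **ISOMETRY-TRANSPORT PLUMBING on the rank-`≥ 2` indexed family at the reindexing `Equiv.prodUnique (Fin N) (Fin 1)`** (any rank `N ≥ 2`,
ANY finite place `v` — split or not —, ANY splitting families `𝓢_t` of the pair models `a_t • T_V`, ANY Step-2 characters `μ_{t,•}`).  For members
`i, j`, let `s_t := lineTransportSection … (a_t) v ((𝓢_t).s v) ((𝓢_t).proj_s v)` be their sections transported to the COMMON δ-model `LocalMp F N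
T_V v` (★ `LocalLineModelTransport`; `ω_{s_t} = (𝓢_t).omegaLoc v ∘ (k ↦ k ⊗ 1)` ON THE NOSE, ★ `omega_lineTransportSection_finLocalSplittings`).
IF for a unit `x` with `a_j⁻¹δ ⊗ 1 = x xᶜ (a_i⁻¹δ ⊗ 1)` the transported splitting `q_x s_i q_x⁻¹ = lineTransportSplitting … x … (s_i)` EQUALS `s_j`
(`hsec`), and the Step-3 characters agree (`hχ : chi j = chi i`), THEN «`ω(μ_j, ε_j, χ_j) ≅ ω(μ_i, ε_i, χ_i)`» (`AreIsomorphicRep (quot j)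
(quot i)`, READING L7).  Proof = the proof of ★ `areIsomorphicRep_quot_of_lineTransportSplitting_eq_prodUnique` with `uEquiv` at `2 ≤ N`:
`M_x⁻¹` (★ `lineTransportOp_symm_equivariant`) is `U(V)(F_v)`-equivariant from member `j`'s carrier to member `i`'s, then ★
`LemD1IndexedFamily.areIsomorphicRep_quot_of_equivariant`. [cite: Liu2021, App. D Lemma D.1 (4) (l. 5235); §D.1 Steps 1–3 (l. 5217–5221)]
[cite: MoeglinVignerasWaldspurger1987, Chap. 2 II.1 (A)–(B), Chap. 3 I.1–I.3, IV.4] [cite: HarrisKudlaSweet1996, §1] -/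
theorem areIsomorphicRep_quot_of_lineTransportSplitting_eq_prodUnique₂
    (hV : TV.IsSymm) (hVd : IsUnit TV.det) (hJV : JV = TV.map (algebraMap F E)) (hn : 2 ≤ N)
    {ι : Type} (aOf : ι → Fˣ) (χOf : ι → Chi F E c)
    (𝓢Of : ∀ i, LocalSplitting.FinLocalSplittings F E c N hcδ hδ hd (gram F (Equiv.prodUnique (Fin N) (Fin 1)) TV (TW F (aOf i)))
      (isSymm_gram F (Equiv.prodUnique (Fin N) (Fin 1)) hV (isSymm_TW F (aOf i)))
      (reindex_kronecker_eq_gram_map F E (Equiv.prodUnique (Fin N) (Fin 1)) hJV (JW_eq F E (aOf i))))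
    (μOf : ι → ∀ v : HeightOneSpectrum (𝓞 F), (LocalRing E v)ˣ →* ℂˣ) (hμn : ∀ i v x, ‖((μOf i v x : ℂˣ) : ℂ)‖ = 1)
    (hμc : ∀ i v, Continuous fun x => ((μOf i v x : ℂˣ) : ℂ))
    (hμF : ∀ (i : ι) (v : HeightOneSpectrum (𝓞 F)) (t : (v.adicCompletion F)ˣ),
      μOf i v (Units.map (algebraMap (v.adicCompletion F) (LocalRing E v)).toMonoidHom t) = 1 ↔
        ∃ x : (LocalRing E v)ˣ, (x : LocalRing E v) * conjLocal E c v x = algebraMap (v.adicCompletion F) (LocalRing E v) t)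
    (v : HeightOneSpectrum (𝓞 F)) (i j : ι) (x : (LocalRing E v)ˣ)
    (hx : algebraMap E (LocalRing E v) (algebraMap F E (↑(aOf j)⁻¹ : F) * δ) =
      (x : LocalRing E v) * conjLocal E c v x * algebraMap E (LocalRing E v) (algebraMap F E (↑(aOf i)⁻¹ : F) * δ))
    (hsec : lineTransportSplitting E v c N (conj_lineDelta hcδ (aOf i)) (lineDelta_ne_zero hδ (aOf i)) (lineDelta_mul_self hd (aOf i))
        (conj_lineDelta hcδ (aOf j)) (lineDelta_ne_zero hδ (aOf j)) (lineDelta_mul_self hd (aOf j)) x TV hV hVd hx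
        (lineTransportSection F E c N hcδ hδ hd TV hV JV hJV (aOf i) v ((𝓢Of i).s v) ((𝓢Of i).proj_s v)) =
      lineTransportSection F E c N hcδ hδ hd TV hV JV hJV (aOf j) v ((𝓢Of j).s v) ((𝓢Of j).proj_s v))
    (hχ : (localIndexedFamilyAtV₂ F E c N (Equiv.prodUnique (Fin N) (Fin 1)) JV hcδ hδ hd hV hVd hJV hn aOf χOf 𝓢Of μOf hμn hμc hμF v).chi j =
      (localIndexedFamilyAtV₂ F E c N (Equiv.prodUnique (Fin N) (Fin 1)) JV hcδ hδ hd hV hVd hJV hn aOf χOf 𝓢Of μOf hμn hμc hμF v).chi i) :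
    AreIsomorphicRep
      ((localIndexedFamilyAtV₂ F E c N (Equiv.prodUnique (Fin N) (Fin 1)) JV hcδ hδ hd hV hVd hJV hn aOf χOf 𝓢Of μOf hμn hμc hμF v).quot j)
      ((localIndexedFamilyAtV₂ F E c N (Equiv.prodUnique (Fin N) (Fin 1)) JV hcδ hδ hd hV hVd hJV hn aOf χOf 𝓢Of μOf hμn hμc hμF v).quot i) := by
  refine LemD1IndexedFamily.areIsomorphicRep_quot_of_equivariant _
    (lineTransportOp E v c N (conj_lineDelta hcδ (aOf i)) (lineDelta_ne_zero hδ (aOf i)) (lineDelta_mul_self hd (aOf i))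
      (conj_lineDelta hcδ (aOf j)) (lineDelta_ne_zero hδ (aOf j)) (lineDelta_mul_self hd (aOf j)) x TV hV hVd hx).symm
    (fun g Φ => ?_) hχ
  -- `ω_{s_t}(g') Ψ = ((𝓢_t).omegaLoc v ∘ (k ↦ k ⊗ 1))(g') Ψ` for `t = i, j` (the model transport, ON THE NOSE)
  have ei := fun (g' : localPi E c N JV v) (Ψ : SchwartzBruhat (Fin N → v.adicCompletion F)) => LinearMap.congr_fun
    (DFunLike.congr_fun (omega_lineTransportSection_finLocalSplittings F E c N hcδ hδ hd TV hV JV hJV (aOf i) v (𝓢Of i)) g') Ψ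
  have ej := fun (g' : localPi E c N JV v) (Ψ : SchwartzBruhat (Fin N → v.adicCompletion F)) => LinearMap.congr_fun
    (DFunLike.congr_fun (omega_lineTransportSection_finLocalSplittings F E c N hcδ hδ hd TV hV JV hJV (aOf j) v (𝓢Of j)) g') Ψ
  -- `M_x⁻¹ ω_{q_x s_i q_x⁻¹}(g') Φ = ω_{s_i}(g') (M_x⁻¹ Φ)` at `g' = uEquiv g`, with `q_x s_i q_x⁻¹ = s_j`
  have key := lineTransportOp_symm_equivariant E v c N (conj_lineDelta hcδ (aOf i)) (lineDelta_ne_zero hδ (aOf i))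
    (lineDelta_mul_self hd (aOf i)) (conj_lineDelta hcδ (aOf j)) (lineDelta_ne_zero hδ (aOf j)) (lineDelta_mul_self hd (aOf j)) x TV hV
    hVd hx (lineTransportSection F E c N hcδ hδ hd TV hV JV hJV (aOf i) v ((𝓢Of i).s v) ((𝓢Of i).proj_s v))
    (LemD1OfPlace.uEquiv E v c N JV hcδ hδ hn (transpose_map_conj_JV F E c N JV hV hJV) (det_JV_ne_zero F E N JV hVd hJV) g) Φ
  rw [hsec, ej, ei] at key
  exact key

/-! ## §4 The same in the Θ-currency of ★ (r1) `areIsomorphicRep_localType₂_iff_quot` -/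

/-- **ISOMETRY-TRANSPORT PLUMBING IN THE Θ-CURRENCY** (the tokens the L4-if assembler composes): under the hypotheses of §3 (`hx`, `hsec`,
`hχ`), the θ-package LOCAL FACTORS `Θ_v(t) := TwistedCoinv.rep (χ_{t,v}) ((𝓢_t).omegaLoc v) _ ∘ (k ↦ k ⊗ 1)` of the two members satisfy
**`Θ_v(j) ≅ Θ_v(i)`** as representations of `U(J_V)(F_v)` — §3 read through ★ (r1) `areIsomorphicRep_localType₂_iff_quot`.
[cite: Liu2021, App. D Lemma D.1 (4) (l. 5235); §D.1 Step 3 (l. 5221)] [cite: MoeglinVignerasWaldspurger1987, Chap. 3 I.1–I.3, IV.4] -/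
theorem areIsomorphicRep_theta_of_lineTransportSplitting_eq_prodUnique₂
    (hV : TV.IsSymm) (hVd : IsUnit TV.det) (hJV : JV = TV.map (algebraMap F E)) (hn : 2 ≤ N)
    {ι : Type} (aOf : ι → Fˣ) (χOf : ι → Chi F E c)
    (𝓢Of : ∀ i, LocalSplitting.FinLocalSplittings F E c N hcδ hδ hd (gram F (Equiv.prodUnique (Fin N) (Fin 1)) TV (TW F (aOf i)))
      (isSymm_gram F (Equiv.prodUnique (Fin N) (Fin 1)) hV (isSymm_TW F (aOf i)))
      (reindex_kronecker_eq_gram_map F E (Equiv.prodUnique (Fin N) (Fin 1)) hJV (JW_eq F E (aOf i))))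
    (μOf : ι → ∀ v : HeightOneSpectrum (𝓞 F), (LocalRing E v)ˣ →* ℂˣ) (hμn : ∀ i v x, ‖((μOf i v x : ℂˣ) : ℂ)‖ = 1)
    (hμc : ∀ i v, Continuous fun x => ((μOf i v x : ℂˣ) : ℂ))
    (hμF : ∀ (i : ι) (v : HeightOneSpectrum (𝓞 F)) (t : (v.adicCompletion F)ˣ),
      μOf i v (Units.map (algebraMap (v.adicCompletion F) (LocalRing E v)).toMonoidHom t) = 1 ↔
        ∃ x : (LocalRing E v)ˣ, (x : LocalRing E v) * conjLocal E c v x = algebraMap (v.adicCompletion F) (LocalRing E v) t)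
    (v : HeightOneSpectrum (𝓞 F)) (i j : ι) (x : (LocalRing E v)ˣ)
    (hx : algebraMap E (LocalRing E v) (algebraMap F E (↑(aOf j)⁻¹ : F) * δ) =
      (x : LocalRing E v) * conjLocal E c v x * algebraMap E (LocalRing E v) (algebraMap F E (↑(aOf i)⁻¹ : F) * δ))
    (hsec : lineTransportSplitting E v c N (conj_lineDelta hcδ (aOf i)) (lineDelta_ne_zero hδ (aOf i)) (lineDelta_mul_self hd (aOf i))
        (conj_lineDelta hcδ (aOf j)) (lineDelta_ne_zero hδ (aOf j)) (lineDelta_mul_self hd (aOf j)) x TV hV hVd hx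
        (lineTransportSection F E c N hcδ hδ hd TV hV JV hJV (aOf i) v ((𝓢Of i).s v) ((𝓢Of i).proj_s v)) =
      lineTransportSection F E c N hcδ hδ hd TV hV JV hJV (aOf j) v ((𝓢Of j).s v) ((𝓢Of j).proj_s v))
    (hχ : (localIndexedFamilyAtV₂ F E c N (Equiv.prodUnique (Fin N) (Fin 1)) JV hcδ hδ hd hV hVd hJV hn aOf χOf 𝓢Of μOf hμn hμc hμF v).chi j =
      (localIndexedFamilyAtV₂ F E c N (Equiv.prodUnique (Fin N) (Fin 1)) JV hcδ hδ hd hV hVd hJV hn aOf χOf 𝓢Of μOf hμn hμc hμF v).chi i) :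
    AreIsomorphicRep
      (show Representation ℂ (UnitaryGroup.localPi E c N JV v) _ from
        (TwistedCoinv.rep (localCharOfCenter F E c (JW F E (aOf j)) (JW_apply_ne_zero F E (aOf j)) (χOf j).1 v) ((𝓢Of j).omegaLoc v)
          (commute_omegaLoc_localCenter F E c N (Equiv.prodUnique (Fin N) (Fin 1)) JV (JW F E (aOf j)) hcδ hδ hd hV (isSymm_TW F (aOf j)) hJV
            (JW_eq F E (aOf j)) (JW_apply_ne_zero F E (aOf j)) (𝓢Of j) v)).comp
          (UnitaryGroup.localLineInl E c N (Equiv.prodUnique (Fin N) (Fin 1)) JV (JW F E (aOf j)) v))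
      (show Representation ℂ (UnitaryGroup.localPi E c N JV v) _ from
        (TwistedCoinv.rep (localCharOfCenter F E c (JW F E (aOf i)) (JW_apply_ne_zero F E (aOf i)) (χOf i).1 v) ((𝓢Of i).omegaLoc v)
          (commute_omegaLoc_localCenter F E c N (Equiv.prodUnique (Fin N) (Fin 1)) JV (JW F E (aOf i)) hcδ hδ hd hV (isSymm_TW F (aOf i)) hJV
            (JW_eq F E (aOf i)) (JW_apply_ne_zero F E (aOf i)) (𝓢Of i) v)).comp
          (UnitaryGroup.localLineInl E c N (Equiv.prodUnique (Fin N) (Fin 1)) JV (JW F E (aOf i)) v)) :=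
  (areIsomorphicRep_localType₂_iff_quot F E c N (Equiv.prodUnique (Fin N) (Fin 1)) JV hcδ hδ hd hV hVd hJV hn aOf χOf 𝓢Of μOf hμn hμc hμF
      v i j).1
    (areIsomorphicRep_quot_of_lineTransportSplitting_eq_prodUnique₂ F E c N JV hcδ hδ hd hV hVd hJV hn aOf χOf 𝓢Of μOf hμn hμc hμF v i j x
      hx hsec hχ)

end Literature.NumberTheory.Automorphic.Liu2021.Def411WeilCarriers

end
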